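import Mathlib
import Literature.Analysis.FluidPDE.VectorCalculus

/-!
# Rosenhead kernel: response to a perturbation of the squared chord

Tools stub `stub_kernelPerturbation` of line `Sketch` (crux `SkeletonEquilibrium`, thesis
`FilamentSkeletonRss`). With `K_e(z) = (‖z‖² + e²)^{-3/2}` the Rosenhead-regularised
Biot–Savart kernel, along a gently curved filament the squared regularised chord reads
`‖z‖² + e² = q₀ + ρ` with `q₀ = s² + e² > 0` and a perturbation `|ρ| ≤ q₀ / 2`. We prove the
scalar estimate, uniform in the core `e`,

`|(q₀ + ρ)^{-3/2} − q₀^{-3/2}| ≤ 9 |ρ| / q₀^{5/2}`.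

Proof (no calculus). Put `p = √(q₀ + ρ) > 0`, `q = √q₀ > 0`, so that
`(q₀ + ρ)^{3/2} = p³`, `q₀^{3/2} = q³`, `q₀^{5/2} = q⁵`, `ρ = p² − q²` and `q² ≤ 2 p²`. Then
`p⁻³ − q⁻³ = (q − p)(q² + q p + p²) / (p³ q³)` and `p² − q² = (p − q)(p + q)`, so it suffices
to show `(q² + q p + p²) / (p³ q³) ≤ 9 (p + q) / q⁵`, i.e.
`q² (q² + q p + p²) ≤ 9 (p + q) p³`, which follows from `q² ≤ 2 p²`:
`q⁴ + q³ p + q² p² ≤ 4 p⁴ + 2 q p³ + 2 p⁴ ≤ 9 p⁴ + 9 q p³`.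
-/

noncomputable section

open MeasureTheory Filter Topology
open Literature.Analysis.FluidPDE

namespace Summit.NavierStokesRegularity.NavierStokesRegularity.Theorems.SkeletonEquilibrium.Sketch
set_option linter.dupNamespace false

/-- `x ^ (3/2) = (√x)³` for `0 ≤ x`. [folklore] -/
private theorem kp_rpow_three_halves_eq {x : ℝ} (hx : 0 ≤ x) :
    x ^ (3 / 2 : ℝ) = Real.sqrt x ^ 3 := by
  rw [Real.rpow_div_two_eq_sqrt 3 hx, Real.rpow_ofNat]

/-- `x ^ (5/2) = (√x)⁵` for `0 ≤ x`. [folklore] -/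
private theorem kp_rpow_five_halves_eq {x : ℝ} (hx : 0 ≤ x) :
    x ^ (5 / 2 : ℝ) = Real.sqrt x ^ 5 := by
  rw [Real.rpow_div_two_eq_sqrt 5 hx, Real.rpow_ofNat]

/-- Polynomial core: for `p, q > 0` with `q² ≤ 2 p²`,
`(q² + q p + p²) q⁵ ≤ 9 (p + q) (p³ q³)`. [folklore] -/
private theorem kp_poly_core {p q : ℝ} (hp : 0 < p) (hq : 0 < q) (hcmp : q ^ 2 ≤ 2 * p ^ 2) :
    (q ^ 2 + q * p + p ^ 2) * q ^ 5 ≤ 9 * (p + q) * (p ^ 3 * q ^ 3) := by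
  have h2 : 0 ≤ 2 * p ^ 2 - q ^ 2 := sub_nonneg.mpr hcmp
  nlinarith [mul_nonneg h2 (pow_nonneg hq.le 5),
    mul_nonneg h2 (mul_nonneg hp.le (pow_nonneg hq.le 4)),
    mul_nonneg h2 (mul_nonneg (pow_nonneg hp.le 2) (pow_nonneg hq.le 3)),
    mul_nonneg (pow_nonneg hp.le 4) (pow_nonneg hq.le 3),
    mul_nonneg (pow_nonneg hp.le 3) (pow_nonneg hq.le 4)]

/-- Square-root form of the estimate: for `p, q > 0` with `q² ≤ 2 p²`,
`|p⁻³ − q⁻³| ≤ 9 |p² − q²| / q⁵`. [folklore] -/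
private theorem kp_sqrt_form {p q : ℝ} (hp : 0 < p) (hq : 0 < q) (hcmp : q ^ 2 ≤ 2 * p ^ 2) :
    |(p ^ 3)⁻¹ - (q ^ 3)⁻¹| ≤ 9 * |p ^ 2 - q ^ 2| / q ^ 5 := by
  have hp0 : p ≠ 0 := hp.ne'
  have hq0 : q ≠ 0 := hq.ne'
  have hkey : (p ^ 3)⁻¹ - (q ^ 3)⁻¹ =
      (q - p) * ((q ^ 2 + q * p + p ^ 2) / (p ^ 3 * q ^ 3)) := by
    field_simp
    ring
  have hfac : p ^ 2 - q ^ 2 = (q - p) * (-(p + q)) := by ring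
  have hpos : 0 < (q ^ 2 + q * p + p ^ 2) / (p ^ 3 * q ^ 3) := by positivity
  have hpq : 0 < p + q := by positivity
  rw [hkey, hfac, abs_mul, abs_mul, abs_neg, abs_of_pos hpos, abs_of_pos hpq]
  have hineq : (q ^ 2 + q * p + p ^ 2) / (p ^ 3 * q ^ 3) ≤ 9 * (p + q) / q ^ 5 := by
    rw [div_le_div_iff₀ (by positivity) (by positivity)]
    exact kp_poly_core hp hq hcmp
  calc |q - p| * ((q ^ 2 + q * p + p ^ 2) / (p ^ 3 * q ^ 3))
      ≤ |q - p| * (9 * (p + q) / q ^ 5) := mul_le_mul_of_nonneg_left hineq (abs_nonneg _)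
    _ = 9 * (|q - p| * (p + q)) / q ^ 5 := by ring

/-- **Tools stub** (`stub_kernelPerturbation`): response of the Rosenhead-regularised
Biot–Savart kernel `x ↦ x^{-3/2}` (in the squared regularised chord `x = ‖z‖² + e²`) to a
perturbation of the squared chord, uniformly in the core: for `q₀ > 0` and `|ρ| ≤ q₀ / 2`,
`|(q₀ + ρ)^{-3/2} − q₀^{-3/2}| ≤ 9 |ρ| / q₀^{5/2}`. [folklore] -/
theorem stub_kernelPerturbation :
    ∀ (q₀ ρ : ℝ), 0 < q₀ → |ρ| ≤ q₀ / 2 →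
      |((q₀ + ρ) ^ (3 / 2 : ℝ))⁻¹ - (q₀ ^ (3 / 2 : ℝ))⁻¹| ≤ 9 * |ρ| / q₀ ^ (5 / 2 : ℝ) := by
  intro q₀ ρ hq₀ hρ
  obtain ⟨hρ₁, -⟩ := abs_le.mp hρ
  have ha : 0 < q₀ + ρ := by linarith
  have hp : 0 < Real.sqrt (q₀ + ρ) := Real.sqrt_pos.mpr ha
  have hq : 0 < Real.sqrt q₀ := Real.sqrt_pos.mpr hq₀
  have hp2 : Real.sqrt (q₀ + ρ) ^ 2 = q₀ + ρ := Real.sq_sqrt ha.le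
  have hq2 : Real.sqrt q₀ ^ 2 = q₀ := Real.sq_sqrt hq₀.le
  have hcmp : Real.sqrt q₀ ^ 2 ≤ 2 * Real.sqrt (q₀ + ρ) ^ 2 := by
    rw [hp2, hq2]
    linarith
  have hρeq : |ρ| = |Real.sqrt (q₀ + ρ) ^ 2 - Real.sqrt q₀ ^ 2| := by
    rw [hp2, hq2]
    congr 1
    ring
  rw [kp_rpow_three_halves_eq ha.le, kp_rpow_three_halves_eq hq₀.le,
    kp_rpow_five_halves_eq hq₀.le, hρeq]
  exact kp_sqrt_form hp hq hcmp

end Summit.NavierStokesRegularity.NavierStokesRegularity.Theorems.SkeletonEquilibrium.Sketch
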